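import Summits.ABC.IUTFork.Repair.RHReachLedgerQ2GenuineUntied
import Summits.ABC.IUTFork.Repair.RHReachLedgerQ2AbcRecut
import Literature.IUT.LogVolume.GenuineLogThetaPointGalois
import HarnessLib

/-!
# R-H ROUND 2 Q2(27) — residual (U) DISCHARGED on the RATIONAL-`j` bed (`j(λ) ∈ ℚ ⟹ K/ℚ Galois`), and the R14 recut of the
# certificate-free chain: `HStar27OnSigma27 ∧ (j ∈ ℚ ∧ untied)|Σ₂₇ ∧ NUM(deep ∧ bad) ∧ CONE-bad ⟹ ABC`

PROOF-ONLY file (0 definitions, 0 `Prop` facts, no instance, no notation; abc-iut cell, D-0079 RESCUE sub-cell R-H, rung LADDER-ABC:A2.RESCUE.H;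
pair n = 10 typer abc-iut-rh-typ-10, author of `Repair/RHReachLedgerQ2{,Genuine,AbcRecut}.lean` (p468994 / p477080 / p480035); sequel BY NAME to
abc-iut-rh2-L1's `Repair/RHReachLedgerQ2GenuineUntied.lean` (`k2Target27_of_isGalois_untied`: `K2Target27` from «every Σ₂₇ datum has `K/ℚ` Galois
and UNTIED bad primes», certificates discharged in kernel)). TAKES NO SIDE on [IUTchIII] Cor. 3.12 / [IUTchIV] Thm. 1.10 or on any author
(Mochizuki / Scholze–Stix / Joshi / Dupuy–Hilado); typed ≠ proved; instantiated ≠ endorsed; nothing here asserts abc proved or refuted.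

WHAT THIS FILE ADDS. The residual (U) of row 27's chain — «`K/ℚ` Galois» in abc-iut-rh2-L1's `cor312NonarchOf_of_ledgerAtDatum_untied_of_isGalois`
— is a THEOREM at every Θ-volume datum of a point `λ` WITH RATIONAL `j`-INVARIANT `j(λ) ∈ ℚ` (in particular at every point presented over
`ℚ`-rational `λ`, the Frey–Hellegouarch bed of Σ₂₇'s KEEP stratum «frey : Szpiro-bad ∧ window»): by the datum's clause `j(E_F) = j(λ)`
(`Cor22.ThetaVolumeDatumAt.j_eq`, [IUTchIV] Thm. 1.10 p. 22) the field of moduli `F_mod = ℚ(j(E_F))` ([IUTchI] Def. 3.1 (b)) is the prime field,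
and `K/F_mod` is Galois ([IUTchI] Rmk. 3.1.5, the tree's `Cor22.ThetaVolumeDatumAt.isGalois_fieldOfModuli_K`, PROVED by the L5 lineage), so `K/ℚ`
is Galois and `Gal(K/ℚ)` makes the ramification index constant on every fibre (abc-iut-rh2-L1's `ramificationIdx_placeOf_eq_of_isGalois`).
* §0 `isGalois_rat_of_isGalois_bot` / `isGalois_rat_of_intermediateField_eq_bot` — field plumbing: `L = ⊥` in `IntermediateField ℚ F` and `K/L`
  Galois for a tower `ℚ ⊆ F ⊆ K` ⟹ `K/ℚ` Galois (`IsGalois.tower_top_of_isGalois` over `IntermediateField.algebraOverBot`).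
* §1 `isGalois_rat_K_of_jInv_mem_range` — `j(λ) ∈ ℚ ⟹ K/ℚ` Galois for EVERY Θ-volume datum `T` at `(P, l)`; `ramificationIdx_placeOf_eq_of_jInv_mem_range`
  — hence uniform fibres of `Cor312Prov.pilotDataOfK T.D T.K`.
* §2 `cor312NonarchOf_of_ledgerAtDatum_untied_of_jInv_mem_range` / `k2Target27_of_jInv_mem_range_untied` — row 27's last arrow and `K2Target27` on
  the stratum «`j(λ) ∈ ℚ` ∧ UNTIED bad primes (`(p−1) ∤ e(𝔭_w ∣ p)`)»: explicit 1, NO witness data, NO Galois hypothesis — a condition on the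
  POINT and the ramification columns only.
* §3 the R14 RECUT of the certificate-free roads (abc-iut-rh2-L1's docstring defers it here): `abc_of_hStar27OnSigma27_of_isGalois_untied_hregBad`
  and `abc_of_hStar27OnSigma27_of_jInv_mem_range_untied_hregBad` — H⋆₂₇|Σ₂₇ · (Galois resp. `j ∈ ℚ`, ∧ untied)|Σ₂₇ · NUM(deep ∧ bad) · CONE-bad
  `hregBad` (abc-iut-s2-p2's binder VERBATIM) ⟹ `ABC`, over p480035's `abc_of_k2Target27_of_hStar27OnSigma27_hregBad` (NOT the blanket `hreg`,
  which `Conditional.not_hreg_v4` refutes). Explicit 4 = H⋆₂₇(Σ₂₇) · STRUCT(Σ₂₇) · NUM(deep ∧ bad) · CONE(Szpiro-bad).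
HONEST SCOPE. `K2Target27` stays OPEN as typed at Σ₂₇ data with a TIED bad prime (`(p−1) ∣ e_w`; every place over `2`) or with `j(λ) ∉ ℚ` and
`K/ℚ` not Galois; H⋆₂₇ (`HStar27OnSigma27`, row 27 «reach-ledger», abc-iut-lens-nearmiss-1) is a HYPOTHESIS SHAPE over OUR typed objects
(Dupuy–Hilado (Ind2) = all `ℤ_p`-lattice automorphisms, STRONGER-THAN-PRINT; SHARP boxes; volume reading of Step (xi)); which genuine data satisfy it
is abc-iut-rh-num-1's table (k1 74.8 % pooled / 98.9 % on frey Szpiro-bad ∧ window), not a theorem; `hregBad` is an assumption label, neither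
proved nor refuted as typed. [cite: Mochizuki2012, IUTchI Def. 3.1 (b) p. 61, Rmk. 3.1.5 p. 65; IUTchIII Cor. 3.12 p. 173–174; IUTchIV Thm. 1.10 p. 22,
Cor. 2.2 (ii) p. 46] [cite: NeukirchANT1999, Ch. I §9 (9.1)] [cite: DupuyHilado2025, §1 (1.1), §3.9] [claim: Mochizuki2012, status: disputed] for every
IUT sentence quoted. Axioms: standard.
-/

noncomputable section

open Set Function NumberField IsDedekindDomain

namespace Summit.ABC.IUTFork.Repair.RH.ReachLedgerQ2

open Thm311 Thm311.Real Cor312 Cor312Vol Cor312Prov Literature.IUT.LogThetaLattice Literature.IUT.LogVolume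
  Literature.IUT.HodgeTheaters Literature.IUT.LogVolume.ThetaData Summit.ABC.IUTFork.Repair.RH.ReachLedger
open Literature.NumberTheory.DiophantineGeometry Literature.NumberTheory.DiophantineGeometry.GenEll Summit.ABC.ABC.Theorems
  Summit.ABC.IUTFork.Conditional
open scoped Classical

/-! ## §0. Field plumbing: Galois over the bottom intermediate field of a tower `ℚ ⊆ F ⊆ K` is Galois over `ℚ` -/

section Plumbing

variable {F K : Type*} [Field F] [NumberField F] [Field K] [CharZero K] [Algebra F K]

/-- For a tower `ℚ ⊆ F ⊆ K`: if `K` is Galois over the bottom intermediate field `⊥ = ℚ·1 ⊆ F`, then `K/ℚ` is Galois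
(`IsGalois.tower_top_of_isGalois` for the tower `⊥ ⊆ ℚ ⊆ K` over Mathlib's `IntermediateField.algebraOverBot`). [folklore] -/
theorem isGalois_rat_of_isGalois_bot [h : IsGalois (⊥ : IntermediateField ℚ F) K] : IsGalois ℚ K := by
  haveI : IsScalarTower (⊥ : IntermediateField ℚ F) ℚ K := IsScalarTower.of_algebraMap_eq fun x => by
    rw [IsScalarTower.algebraMap_apply ℚ F K, ← IsScalarTower.algebraMap_apply (⊥ : IntermediateField ℚ F) ℚ F,
      IsScalarTower.algebraMap_apply (⊥ : IntermediateField ℚ F) F K]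
  exact IsGalois.tower_top_of_isGalois (⊥ : IntermediateField ℚ F) ℚ K

/-- For a tower `ℚ ⊆ F ⊆ K` and an intermediate field `L` of `F/ℚ` which is the prime field (`L = ⊥`): `K/L` Galois ⟹ `K/ℚ` Galois. [folklore] -/
theorem isGalois_rat_of_intermediateField_eq_bot {L : IntermediateField ℚ F} (hL : L = ⊥) [h : IsGalois L K] : IsGalois ℚ K := by
  subst hL
  exact isGalois_rat_of_isGalois_bot (F := F)

end Plumbing

/-! ## §1. `j(λ) ∈ ℚ ⟹ K/ℚ` Galois for every Θ-volume datum, hence uniform fibres -/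

/-- **`j(λ) ∈ ℚ ⟹ K/ℚ` IS GALOIS** for every genuine Θ-volume datum `T` at `(P, l)`: the datum's curve has `j(E_F) = j(λ)`
(`Cor22.ThetaVolumeDatumAt.j_eq`), so for `j(λ) ∈ ℚ` the field of moduli `F_mod = ℚ(j(E_F)) ⊆ F` ([IUTchI] Def. 3.1 (b), tree `fieldOfModuli`) is
`⊥`, and `K/F_mod` is Galois ([IUTchI] Rmk. 3.1.5, `Cor22.ThetaVolumeDatumAt.isGalois_fieldOfModuli_K`, PROVED) ⟹ `K/ℚ` Galois (§0).
[cite: Mochizuki2012, IUTchI Def. 3.1 (b) p. 61, Rmk. 3.1.5 p. 65; IUTchIV Thm. 1.10 p. 22] [claim: Mochizuki2012, status: disputed] -/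
theorem isGalois_rat_K_of_jInv_mem_range {P : NFPoint} {l : ℕ} (T : Cor22.ThetaVolumeDatumAt P l)
    (hj : Cor22.jInv P.x ∈ Set.range (algebraMap ℚ P.F)) :
    (letI := T.instFieldF; letI := T.instNumberFieldF; letI := T.instFieldK; letI := T.instNumberFieldK; letI := T.instAlgebraK;
      IsGalois ℚ T.K) := by
  letI := T.instFieldF; letI := T.instNumberFieldF; letI := T.instAlgebraF; letI := T.instFieldK
  letI := T.instNumberFieldK; letI := T.instAlgebraK; letI := T.instFieldFbar; letI := T.instAlgebraFbar
  letI := T.instAlgebraKFbar; letI := T.instIsElliptic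
  have hbot : fieldOfModuli T.E = ⊥ := by
    unfold fieldOfModuli
    rw [IntermediateField.adjoin_simple_eq_bot_iff, IntermediateField.mem_bot]
    obtain ⟨q, hq⟩ := hj
    exact ⟨q, by rw [T.j_eq, ← hq]; exact IsScalarTower.algebraMap_apply ℚ P.F T.F q⟩
  haveI : IsGalois (fieldOfModuli T.E) T.K := T.isGalois_fieldOfModuli_K
  exact isGalois_rat_of_intermediateField_eq_bot hbot

/-- **… HENCE UNIFORM FIBRES on the genuine bed**: for `j(λ) ∈ ℚ`, `e(𝔭_x ∣ p) = e(𝔭_w ∣ p)` for any two fibre points `x, w ∣ p` of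
`Cor312Prov.pilotDataOfK T.D T.K` (abc-iut-rh2-L1's `ramificationIdx_placeOf_eq_of_isGalois` under §1's Galois structure) — residual (U) of row 27's
chain DISCHARGED on the rational-`j` bed. [cite: NeukirchANT1999, Ch. I §9 (9.1)] [claim: Mochizuki2012, status: disputed] -/
theorem ramificationIdx_placeOf_eq_of_jInv_mem_range {P : NFPoint} {l : ℕ} (T : Cor22.ThetaVolumeDatumAt P l)
    (hj : Cor22.jInv P.x ∈ Set.range (algebraMap ℚ P.F)) :
    letI := T.instFieldF; letI := T.instNumberFieldF; letI := T.instAlgebraF; letI := T.instFieldK;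
    letI := T.instNumberFieldK; letI := T.instAlgebraK; letI := T.instFieldFbar; letI := T.instAlgebraFbar;
    letI := T.instAlgebraKFbar; letI := T.instIsElliptic;
    ∀ (pp : Nat.Primes) (w x : (thetaIndex (pilotDataOfK T.D T.K)).Fibre (.inr pp)), haveI : Fact (pp : ℕ).Prime := ⟨pp.2⟩
      (placeOf (pilotDataOfK T.D T.K) pp.1 x).asIdeal.ramificationIdx ℤ = (placeOf (pilotDataOfK T.D T.K) pp.1 w).asIdeal.ramificationIdx ℤ := by
  letI := T.instFieldF; letI := T.instNumberFieldF; letI := T.instAlgebraF; letI := T.instFieldK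
  letI := T.instNumberFieldK; letI := T.instAlgebraK; letI := T.instFieldFbar; letI := T.instAlgebraFbar
  letI := T.instAlgebraKFbar; letI := T.instIsElliptic
  haveI := isGalois_rat_K_of_jInv_mem_range T hj
  intro pp w x
  exact ramificationIdx_placeOf_eq_of_isGalois (pilotDataOfK T.D T.K) pp w x

section KFamily

variable
    (M : ∀ (P : NFPoint) (l : ℕ) (T : Cor22.ThetaVolumeDatumAt P l), Type) [∀ P l T, Field (M P l T)] [∀ P l T, NumberField (M P l T)]
    (archPk : ∀ (P : NFPoint) (l : ℕ) (T : Cor22.ThetaVolumeDatumAt P l), letI := T.instFieldF; letI := T.instNumberFieldF; letI := T.instAlgebraF; letI := T.instFieldK;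
        letI := T.instNumberFieldK; letI := T.instAlgebraK; letI := T.instFieldFbar; letI := T.instAlgebraFbar;
        letI := T.instAlgebraKFbar; letI := T.instIsElliptic;
      ∀ (j : (thetaIndex (pilotDataOfK T.D T.K)).Label) (vQ : (thetaIndex (pilotDataOfK T.D T.K)).VQ), Set ((logShellsDH (pilotDataOfK T.D T.K) (analyticLogv T.K)).Packet j vQ))
    (archSub : ∀ (P : NFPoint) (l : ℕ) (T : Cor22.ThetaVolumeDatumAt P l), letI := T.instFieldF; letI := T.instNumberFieldF; letI := T.instAlgebraF; letI := T.instFieldK;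
        letI := T.instNumberFieldK; letI := T.instAlgebraK; letI := T.instFieldFbar; letI := T.instAlgebraFbar;
        letI := T.instAlgebraKFbar; letI := T.instIsElliptic;
      ∀ (j : (thetaIndex (pilotDataOfK T.D T.K)).Label) (v : (thetaIndex (pilotDataOfK T.D T.K)).V), Set ((logShellsDH (pilotDataOfK T.D T.K) (analyticLogv T.K)).Packet j ((thetaIndex (pilotDataOfK T.D T.K)).over v)))
    (Ψ : ∀ (P : NFPoint) (l : ℕ) (T : Cor22.ThetaVolumeDatumAt P l), letI := T.instFieldF; letI := T.instNumberFieldF; letI := T.instAlgebraF; letI := T.instFieldK;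
        letI := T.instNumberFieldK; letI := T.instAlgebraK; letI := T.instFieldFbar; letI := T.instAlgebraFbar;
        letI := T.instAlgebraKFbar; letI := T.instIsElliptic;
      ℤ → ∀ v : (thetaIndex (pilotDataOfK T.D T.K)).V, v ∈ (thetaIndex (pilotDataOfK T.D T.K)).Vbad → Set ((logShellsDH (pilotDataOfK T.D T.K) (analyticLogv T.K)).StarPacket v))
    (act : ∀ (P : NFPoint) (l : ℕ) (T : Cor22.ThetaVolumeDatumAt P l), letI := T.instFieldF; letI := T.instNumberFieldF; letI := T.instAlgebraF; letI := T.instFieldK;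
        letI := T.instNumberFieldK; letI := T.instAlgebraK; letI := T.instFieldFbar; letI := T.instAlgebraFbar;
        letI := T.instAlgebraKFbar; letI := T.instIsElliptic;
      ℤ → ∀ v : (thetaIndex (pilotDataOfK T.D T.K)).V, v ∈ (thetaIndex (pilotDataOfK T.D T.K)).Vbad → (logShellsDH (pilotDataOfK T.D T.K) (analyticLogv T.K)).StarPacket v → Module.End ℚ ((logShellsDH (pilotDataOfK T.D T.K) (analyticLogv T.K)).StarPacket v))
    (Mmod : ∀ (P : NFPoint) (l : ℕ) (T : Cor22.ThetaVolumeDatumAt P l), letI := T.instFieldF; letI := T.instNumberFieldF; letI := T.instAlgebraF; letI := T.instFieldK;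
        letI := T.instNumberFieldK; letI := T.instAlgebraK; letI := T.instFieldFbar; letI := T.instAlgebraFbar;
        letI := T.instAlgebraKFbar; letI := T.instIsElliptic;
      ℤ → ∀ j : (thetaIndex (pilotDataOfK T.D T.K)).LabelStar, Set ((logShellsDH (pilotDataOfK T.D T.K) (analyticLogv T.K)).GlobalPacket j.1))
    (region : ∀ (P : NFPoint) (l : ℕ) (T : Cor22.ThetaVolumeDatumAt P l), letI := T.instFieldF; letI := T.instNumberFieldF; letI := T.instAlgebraF; letI := T.instFieldK;
        letI := T.instNumberFieldK; letI := T.instAlgebraK; letI := T.instFieldFbar; letI := T.instAlgebraFbar;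
        letI := T.instAlgebraKFbar; letI := T.instIsElliptic;
      ℤ → ∀ j : (thetaIndex (pilotDataOfK T.D T.K)).LabelStar, FinDivisor (M P l T) → ∀ vQ : (thetaIndex (pilotDataOfK T.D T.K)).VQ, Set ((logShellsDH (pilotDataOfK T.D T.K) (analyticLogv T.K)).Packet j.1 vQ))
    (n : ∀ (P : NFPoint) (l : ℕ) (T : Cor22.ThetaVolumeDatumAt P l), ℤ)
    {HT : ∀ (P : NFPoint) (l : ℕ) (T : Cor22.ThetaVolumeDatumAt P l), Type} {LogLink : ∀ (P : NFPoint) (l : ℕ) (T : Cor22.ThetaVolumeDatumAt P l), HT P l T → HT P l T → Type}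
    {IsFull : ∀ (P : NFPoint) (l : ℕ) (T : Cor22.ThetaVolumeDatumAt P l), ∀ {s t : HT P l T}, LogLink P l T s t → Prop}
    (lat : ∀ (P : NFPoint) (l : ℕ) (T : Cor22.ThetaVolumeDatumAt P l), LGPGaussianLogThetaLattice (LogLink P l T) (IsFull P l T))
    {Frd : ∀ (P : NFPoint) (l : ℕ) (T : Cor22.ThetaVolumeDatumAt P l), Type} {IsoF : ∀ (P : NFPoint) (l : ℕ) (T : Cor22.ThetaVolumeDatumAt P l), Frd P l T → Frd P l T → Type} {Ob : ∀ (P : NFPoint) (l : ℕ) (T : Cor22.ThetaVolumeDatumAt P l), Frd P l T → Type}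
    {realify : ∀ (P : NFPoint) (l : ℕ) (T : Cor22.ThetaVolumeDatumAt P l), Frd P l T → Frd P l T} {Strip : ∀ (P : NFPoint) (l : ℕ) (T : Cor22.ThetaVolumeDatumAt P l), Type} {IsoS : ∀ (P : NFPoint) (l : ℕ) (T : Cor22.ThetaVolumeDatumAt P l), Strip P l T → Strip P l T → Type}
    {Mv : ∀ (P : NFPoint) (l : ℕ) (T : Cor22.ThetaVolumeDatumAt P l), letI := T.instFieldF; letI := T.instNumberFieldF; letI := T.instAlgebraF; letI := T.instFieldK;
        letI := T.instNumberFieldK; letI := T.instAlgebraK; letI := T.instFieldFbar; letI := T.instAlgebraFbar;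
        letI := T.instAlgebraKFbar; letI := T.instIsElliptic;
      ∀ v : (thetaIndex (pilotDataOfK T.D T.K)).V, v ∈ (thetaIndex (pilotDataOfK T.D T.K)).Vbad → Type}
    [∀ P l T v h, Monoid (Mv P l T v h)]
    (sig : ∀ (P : NFPoint) (l : ℕ) (T : Cor22.ThetaVolumeDatumAt P l), letI := T.instFieldF; letI := T.instNumberFieldF; letI := T.instAlgebraF; letI := T.instFieldK;
        letI := T.instNumberFieldK; letI := T.instAlgebraK; letI := T.instFieldFbar; letI := T.instAlgebraFbar;
        letI := T.instAlgebraKFbar; letI := T.instIsElliptic;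
      GlobalLGPFrobenioidSignature (thetaIndex (pilotDataOfK T.D T.K)).lstar (thetaIndex (pilotDataOfK T.D T.K)).V (· ∈ (thetaIndex (pilotDataOfK T.D T.K)).Vbad) (Frd P l T) (IsoF P l T) (Ob P l T) (realify P l T)
        (Strip P l T) (IsoS P l T) (Mv P l T))
    (split : ∀ (P : NFPoint) (l : ℕ) (T : Cor22.ThetaVolumeDatumAt P l), SplittingMonoids (Mv P l T))
    {ObΔ : ∀ (P : NFPoint) (l : ℕ) (T : Cor22.ThetaVolumeDatumAt P l), Type} {N : ∀ (P : NFPoint) (l : ℕ) (T : Cor22.ThetaVolumeDatumAt P l), letI := T.instFieldF; letI := T.instNumberFieldF; letI := T.instAlgebraF; letI := T.instFieldK;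
        letI := T.instNumberFieldK; letI := T.instAlgebraK; letI := T.instFieldFbar; letI := T.instAlgebraFbar;
        letI := T.instAlgebraKFbar; letI := T.instIsElliptic;
      ∀ v : (thetaIndex (pilotDataOfK T.D T.K)).V, v ∈ (thetaIndex (pilotDataOfK T.D T.K)).Vbad → Type}
    [∀ P l T v h, Monoid (N P l T v h)] (qData : ∀ (P : NFPoint) (l : ℕ) (T : Cor22.ThetaVolumeDatumAt P l), QPilotData (ObΔ P l T) (N P l T))


include M archPk archSub Ψ act Mmod region n lat sig split qData in
/-- **RATIONAL-`j` rows: `LedgerAtDatum T` ∧ (T) ⟹ `T.Cor312NonarchOf`** — abc-iut-rh2-L1's `cor312NonarchOf_of_ledgerAtDatum_untied` with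
its uniform-fibre hypothesis (U) DISCHARGED by §1 (`ramificationIdx_placeOf_eq_of_jInv_mem_range`, `j(λ) ∈ ℚ`); left: the bad primes are UNTIED, `(p−1) ∤ e(𝔭_w ∣ p)`. Row 27's ledger is a HYPOTHESIS;
no side taken on [IUTchIII] Cor. 3.12. [cite: Mochizuki2012, IUTchI Rmk. 3.1.5 p. 65; IUTchIII Cor. 3.12 p. 173–174] [cite: NeukirchANT1999, Ch. I §9 (9.1),
Ch. II (5.5)] [claim: Mochizuki2012, status: disputed] -/
theorem cor312NonarchOf_of_ledgerAtDatum_untied_of_jInv_mem_range {P : NFPoint} {l : ℕ} (T : Cor22.ThetaVolumeDatumAt P l)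
    (hj : Cor22.jInv P.x ∈ Set.range (algebraMap ℚ P.F))
    (hnd : letI := T.instFieldF; letI := T.instNumberFieldF; letI := T.instAlgebraF; letI := T.instFieldK;
        letI := T.instNumberFieldK; letI := T.instAlgebraK; letI := T.instFieldFbar; letI := T.instAlgebraFbar;
        letI := T.instAlgebraKFbar; letI := T.instIsElliptic;
      ∀ (pp : Nat.Primes) (w : (thetaIndex (pilotDataOfK T.D T.K)).Fibre (.inr pp)), haveI : Fact (pp : ℕ).Prime := ⟨pp.2⟩
        placeOf (pilotDataOfK T.D T.K) pp.1 w ∈ (pilotDataOfK T.D T.K).S →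
          ¬ ((pp : ℕ) - 1 ∣ (placeOf (pilotDataOfK T.D T.K) pp.1 w).asIdeal.ramificationIdx ℤ))
    (hL : LedgerAtDatum T) :
    T.Cor312NonarchOf := by
  letI := T.instFieldF; letI := T.instNumberFieldF; letI := T.instAlgebraF; letI := T.instFieldK
  letI := T.instNumberFieldK; letI := T.instAlgebraK; letI := T.instFieldFbar; letI := T.instAlgebraFbar
  letI := T.instAlgebraKFbar; letI := T.instIsElliptic
  exact cor312NonarchOf_of_ledgerAtDatum_untied M archPk archSub Ψ act Mmod region n lat sig split qData T
    (fun pp w x _ => ramificationIdx_placeOf_eq_of_jInv_mem_range T hj pp w x) hnd hL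

include M archPk archSub Ψ act Mmod region n lat sig split qData in
/-- **`K2Target27` on the RATIONAL-`j`, UNTIED stratum** — from ONE structural hypothesis on the POINT and the ramification columns: every Σ₂₇ datum
(antecedents of `K2Target27` VERBATIM) has `j(λ) ∈ ℚ` and untied bad primes. Explicit 1; NO witness data, NO Galois hypothesis ((U) is §1, the
certificates are abc-iut-rh2-L1's theorems). [cite: NeukirchANT1999, Ch. I §9 (9.1), Ch. II (5.5)] [claim: Mochizuki2012, status: disputed] -/
theorem k2Target27_of_jInv_mem_range_untied
    (hJT : ∀ (P : NFPoint), P ∈ UP → ∀ (l : ℕ), l.Prime → 5 ≤ l →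
      Cor22.AdmitsCore P → Cor22.CondP2 P l → Cor22.CondP5 P l → Cor22.CondP6 P l →
      (((l : ℝ) + 5) / 4 < (Cor22.dmod P : ℝ) ∨
        6 * l * (((l : ℝ) + 5) - 4 * Cor22.dmod P) / (((l : ℝ) + 4) * ((l : ℝ) - 3))
            * (P.logDiff + (1 - 1 / (l : ℝ)) * Cor22.logCondAvoid P {2, l})
          + 6 * l * ((l : ℝ) + 5) / (((l : ℝ) + 4) * ((l : ℝ) - 3)) * Real.log Real.pi < Cor22.logQAvoid P {2, l}) →
      ∀ (T : Cor22.ThetaVolumeDatumAt P l), letI := T.instFieldF; letI := T.instNumberFieldF; letI := T.instAlgebraF; letI := T.instFieldK;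
        letI := T.instNumberFieldK; letI := T.instAlgebraK; letI := T.instFieldFbar; letI := T.instAlgebraFbar;
        letI := T.instAlgebraKFbar; letI := T.instIsElliptic;
      ¬ (∃ (pp : Nat.Primes) (_ : 2 < (pp : ℕ)) (i : Fin (thetaIndex (pilotDataOfK T.D T.K)).lstar)
          (x₀ : (thetaIndex (pilotDataOfK T.D T.K)).Fibre (.inr pp)),
        haveI : Fact (pp : ℕ).Prime := ⟨pp.2⟩
        ((pp : ℕ) : ℝ) ^ ((((i : ℕ) : ℝ) + 2) * (4 + 2 * Real.logb (pp : ℕ) (Module.finrank ℚ T.K)) + 1) *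
          ‖(exists_realising_qIdeles_pilotDataOfK T.D).choose pp x₀‖ ^ (((i : ℕ) + 1) ^ 2 - 1) < 1) →
      Cor22.jInv P.x ∈ Set.range (algebraMap ℚ P.F) ∧
        (∀ (pp : Nat.Primes) (w : (thetaIndex (pilotDataOfK T.D T.K)).Fibre (.inr pp)), haveI : Fact (pp : ℕ).Prime := ⟨pp.2⟩
          placeOf (pilotDataOfK T.D T.K) pp.1 w ∈ (pilotDataOfK T.D T.K).S →
            ¬ ((pp : ℕ) - 1 ∣ (placeOf (pilotDataOfK T.D T.K) pp.1 w).asIdeal.ramificationIdx ℤ))) :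
    K2Target27 := by
  intro P hP l hl h5 hc h2 h5' h6 hbad T hwin hL
  obtain ⟨hj, hnd⟩ := hJT P hP l hl h5 hc h2 h5' h6 hbad T hwin
  exact cor312NonarchOf_of_ledgerAtDatum_untied_of_jInv_mem_range M archPk archSub Ψ act Mmod region n lat sig split qData T hj hnd hL

/-! ## §3. The R14 recut of the certificate-free roads to abc (`hregBad`, abc-iut-s2-p2's binder VERBATIM) -/

include M archPk archSub Ψ act Mmod region n lat sig split qData in
/-- **EXPLICIT-4, certificate-free, recut: `HStar27OnSigma27 ∧ (K/ℚ Galois ∧ untied)|Σ₂₇ ∧ NUM(deep ∧ bad) ∧ CONE-bad ⟹ ABC`** — abc-iut-rh2-L1's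
`k2Target27_of_isGalois_untied` (its hypothesis VERBATIM) ∘ p480035's `abc_of_k2Target27_of_hStar27OnSigma27_hregBad` (the cone binder cut to the
SZPIRO-BAD locus, NOT the blanket `hreg` refuted by `Conditional.not_hreg_v4`). Explicit 4 = H⋆₂₇(Σ₂₇) · GAL∧UNTIED(Σ₂₇) · NUM(deep ∧ bad) ·
CONE(Szpiro-bad); H⋆₂₇ is a HYPOTHESIS, `hregBad` an assumption label; nothing asserted; no side taken on [IUTchIII] Cor. 3.12.
[cite: Mochizuki2012, IUTchIII Cor. 3.12 p. 173–174; IUTchIV Cor. 2.2 (ii) p. 46] [cite: NeukirchANT1999, Ch. I §9 (9.1), Ch. II (5.5)]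
[claim: Mochizuki2012, status: disputed] -/
theorem abc_of_hStar27OnSigma27_of_isGalois_untied_hregBad (hS : HStar27OnSigma27)
    (hGT : ∀ (P : NFPoint), P ∈ UP → ∀ (l : ℕ), l.Prime → 5 ≤ l →
      Cor22.AdmitsCore P → Cor22.CondP2 P l → Cor22.CondP5 P l → Cor22.CondP6 P l →
      (((l : ℝ) + 5) / 4 < (Cor22.dmod P : ℝ) ∨
        6 * l * (((l : ℝ) + 5) - 4 * Cor22.dmod P) / (((l : ℝ) + 4) * ((l : ℝ) - 3))
            * (P.logDiff + (1 - 1 / (l : ℝ)) * Cor22.logCondAvoid P {2, l})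
          + 6 * l * ((l : ℝ) + 5) / (((l : ℝ) + 4) * ((l : ℝ) - 3)) * Real.log Real.pi < Cor22.logQAvoid P {2, l}) →
      ∀ (T : Cor22.ThetaVolumeDatumAt P l), letI := T.instFieldF; letI := T.instNumberFieldF; letI := T.instAlgebraF; letI := T.instFieldK;
        letI := T.instNumberFieldK; letI := T.instAlgebraK; letI := T.instFieldFbar; letI := T.instAlgebraFbar;
        letI := T.instAlgebraKFbar; letI := T.instIsElliptic;
      ¬ (∃ (pp : Nat.Primes) (_ : 2 < (pp : ℕ)) (i : Fin (thetaIndex (pilotDataOfK T.D T.K)).lstar)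
          (x₀ : (thetaIndex (pilotDataOfK T.D T.K)).Fibre (.inr pp)),
        haveI : Fact (pp : ℕ).Prime := ⟨pp.2⟩
        ((pp : ℕ) : ℝ) ^ ((((i : ℕ) : ℝ) + 2) * (4 + 2 * Real.logb (pp : ℕ) (Module.finrank ℚ T.K)) + 1) *
          ‖(exists_realising_qIdeles_pilotDataOfK T.D).choose pp x₀‖ ^ (((i : ℕ) + 1) ^ 2 - 1) < 1) →
      IsGalois ℚ T.K ∧
        (∀ (pp : Nat.Primes) (w : (thetaIndex (pilotDataOfK T.D T.K)).Fibre (.inr pp)), haveI : Fact (pp : ℕ).Prime := ⟨pp.2⟩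
          placeOf (pilotDataOfK T.D T.K) pp.1 w ∈ (pilotDataOfK T.D T.K).S →
            ¬ ((pp : ℕ) - 1 ∣ (placeOf (pilotDataOfK T.D T.K) pp.1 w).asIdeal.ramificationIdx ℤ)))
    (hNumBad : ∀ (P : NFPoint), P ∈ UP → ∀ (l : ℕ), l.Prime → 5 ≤ l →
      Cor22.AdmitsCore P → Cor22.CondP2 P l → Cor22.CondP5 P l → Cor22.CondP6 P l →
      -- ONLY at SZPIRO-BAD `(P, l)`: elsewhere `T.Cor312Of` is the theorem `Cor22.ThetaVolumeDatumAt.cor312Of_of_szpiro` (abc-iut-c312-d1)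
      (((l : ℝ) + 5) / 4 < (Cor22.dmod P : ℝ) ∨
        6 * l * (((l : ℝ) + 5) - 4 * Cor22.dmod P) / (((l : ℝ) + 4) * ((l : ℝ) - 3))
            * (P.logDiff + (1 - 1 / (l : ℝ)) * Cor22.logCondAvoid P {2, l})
          + 6 * l * ((l : ℝ) + 5) / (((l : ℝ) + 4) * ((l : ℝ) - 3)) * Real.log Real.pi < Cor22.logQAvoid P {2, l}) →
      ∀ (T : Cor22.ThetaVolumeDatumAt P l), letI := T.instFieldF; letI := T.instNumberFieldF; letI := T.instAlgebraF; letI := T.instFieldK;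
        letI := T.instNumberFieldK; letI := T.instAlgebraK; letI := T.instFieldFbar; letI := T.instAlgebraFbar;
        letI := T.instAlgebraKFbar; letI := T.instIsElliptic;
      (∃ (pp : Nat.Primes) (_ : 2 < (pp : ℕ)) (i : Fin (thetaIndex (pilotDataOfK T.D T.K)).lstar)
          (x₀ : (thetaIndex (pilotDataOfK T.D T.K)).Fibre (.inr pp)),
        haveI : Fact (pp : ℕ).Prime := ⟨pp.2⟩
        ((pp : ℕ) : ℝ) ^ ((((i : ℕ) : ℝ) + 2) * (4 + 2 * Real.logb (pp : ℕ) (Module.finrank ℚ T.K)) + 1) *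
          ‖(exists_realising_qIdeles_pilotDataOfK T.D).choose pp x₀‖ ^ (((i : ℕ) + 1) ^ 2 - 1) < 1) → T.Cor312Of)
    -- [CONE, Szpiro-bad] the off-regime hull estimate with print's constant `B_III(P,l)`, demanded ONLY at SZPIRO-BAD admissible `(P, l)`
    (hregBad : ∀ P : NFPoint, P ∈ UP → ∀ l : ℕ, l.Prime → 5 ≤ l →
      Cor22.AdmitsCore P → Cor22.CondP2 P l → Cor22.CondP5 P l → Cor22.CondP6 P l →
      (((l : ℝ) + 5) / 4 < (Cor22.dmod P : ℝ) ∨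
        6 * l * (((l : ℝ) + 5) - 4 * Cor22.dmod P) / (((l : ℝ) + 4) * ((l : ℝ) - 3))
            * (P.logDiff + (1 - 1 / (l : ℝ)) * Cor22.logCondAvoid P {2, l})
          + 6 * l * ((l : ℝ) + 5) / (((l : ℝ) + 4) * ((l : ℝ) - 3)) * Real.log Real.pi < Cor22.logQAvoid P {2, l}) →
      ∀ T : Cor22.ThetaVolumeDatumAt P l,
        (letI := T.instFieldF; letI := T.instNumberFieldF; letI := T.instAlgebraF; letI := T.instFieldK
         letI := T.instNumberFieldK; letI := T.instAlgebraK; letI := T.instFieldFbar; letI := T.instAlgebraFbar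
         letI := T.instAlgebraKFbar; letI := T.instIsElliptic
         ¬ (∀ p ∈ T.I.supportPrimes, ∀ v w : placesOver (fieldOfModuli T.E) p,
            (Summit.ABC.IUTFork.DHData.ofInput T.I).logQloc p v = (Summit.ABC.IUTFork.DHData.ofInput T.I).logQloc p w)) →
        T.HullEstimateOf
          (((l : ℝ) + 1) / 4 *
            ((1 + 12 * (Cor22.dmod P : ℝ) / l) * (P.logDiff + Cor22.logCondAvoid P {2, l})
              + 2 * Real.log l + 52
              + 20 / 3 * Real.log (((2 ^ 12 * 3 ^ 3 * 5 * Cor22.dmod P : ℕ) : ℝ) * (l : ℝ))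
                * (Nat.primeCounting (2 ^ 12 * 3 ^ 3 * 5 * Cor22.dmod P * l) : ℝ))))
    : _root_.ABC :=
  abc_of_k2Target27_of_hStar27OnSigma27_hregBad
    (k2Target27_of_isGalois_untied M archPk archSub Ψ act Mmod region n lat sig split qData hGT) hS hNumBad hregBad

include M archPk archSub Ψ act Mmod region n lat sig split qData in
/-- **EXPLICIT-4, certificate-free, recut, RATIONAL-`j` bed: `HStar27OnSigma27 ∧ (j(λ) ∈ ℚ ∧ untied)|Σ₂₇ ∧ NUM(deep ∧ bad) ∧ CONE-bad ⟹ ABC`** —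
§2's `k2Target27_of_jInv_mem_range_untied` ∘ p480035's `abc_of_k2Target27_of_hStar27OnSigma27_hregBad`. Explicit 4 = H⋆₂₇(Σ₂₇) · (j ∈ ℚ ∧ UNTIED)(Σ₂₇) ·
NUM(deep ∧ bad) · CONE(Szpiro-bad) — the structural class is a condition on the point and the ramification columns only. H⋆₂₇ is a HYPOTHESIS,
`hregBad` an assumption label; nothing asserted; no side taken on [IUTchIII] Cor. 3.12. [cite: Mochizuki2012, IUTchI Rmk. 3.1.5 p. 65; IUTchIII Cor. 3.12
p. 173–174; IUTchIV Cor. 2.2 (ii) p. 46] [cite: NeukirchANT1999, Ch. I §9 (9.1), Ch. II (5.5)] [claim: Mochizuki2012, status: disputed] -/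
theorem abc_of_hStar27OnSigma27_of_jInv_mem_range_untied_hregBad (hS : HStar27OnSigma27)
    (hJT : ∀ (P : NFPoint), P ∈ UP → ∀ (l : ℕ), l.Prime → 5 ≤ l →
      Cor22.AdmitsCore P → Cor22.CondP2 P l → Cor22.CondP5 P l → Cor22.CondP6 P l →
      (((l : ℝ) + 5) / 4 < (Cor22.dmod P : ℝ) ∨
        6 * l * (((l : ℝ) + 5) - 4 * Cor22.dmod P) / (((l : ℝ) + 4) * ((l : ℝ) - 3))
            * (P.logDiff + (1 - 1 / (l : ℝ)) * Cor22.logCondAvoid P {2, l})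
          + 6 * l * ((l : ℝ) + 5) / (((l : ℝ) + 4) * ((l : ℝ) - 3)) * Real.log Real.pi < Cor22.logQAvoid P {2, l}) →
      ∀ (T : Cor22.ThetaVolumeDatumAt P l), letI := T.instFieldF; letI := T.instNumberFieldF; letI := T.instAlgebraF; letI := T.instFieldK;
        letI := T.instNumberFieldK; letI := T.instAlgebraK; letI := T.instFieldFbar; letI := T.instAlgebraFbar;
        letI := T.instAlgebraKFbar; letI := T.instIsElliptic;
      ¬ (∃ (pp : Nat.Primes) (_ : 2 < (pp : ℕ)) (i : Fin (thetaIndex (pilotDataOfK T.D T.K)).lstar)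
          (x₀ : (thetaIndex (pilotDataOfK T.D T.K)).Fibre (.inr pp)),
        haveI : Fact (pp : ℕ).Prime := ⟨pp.2⟩
        ((pp : ℕ) : ℝ) ^ ((((i : ℕ) : ℝ) + 2) * (4 + 2 * Real.logb (pp : ℕ) (Module.finrank ℚ T.K)) + 1) *
          ‖(exists_realising_qIdeles_pilotDataOfK T.D).choose pp x₀‖ ^ (((i : ℕ) + 1) ^ 2 - 1) < 1) →
      Cor22.jInv P.x ∈ Set.range (algebraMap ℚ P.F) ∧
        (∀ (pp : Nat.Primes) (w : (thetaIndex (pilotDataOfK T.D T.K)).Fibre (.inr pp)), haveI : Fact (pp : ℕ).Prime := ⟨pp.2⟩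
          placeOf (pilotDataOfK T.D T.K) pp.1 w ∈ (pilotDataOfK T.D T.K).S →
            ¬ ((pp : ℕ) - 1 ∣ (placeOf (pilotDataOfK T.D T.K) pp.1 w).asIdeal.ramificationIdx ℤ)))
    (hNumBad : ∀ (P : NFPoint), P ∈ UP → ∀ (l : ℕ), l.Prime → 5 ≤ l →
      Cor22.AdmitsCore P → Cor22.CondP2 P l → Cor22.CondP5 P l → Cor22.CondP6 P l →
      -- ONLY at SZPIRO-BAD `(P, l)`: elsewhere `T.Cor312Of` is the theorem `Cor22.ThetaVolumeDatumAt.cor312Of_of_szpiro` (abc-iut-c312-d1)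
      (((l : ℝ) + 5) / 4 < (Cor22.dmod P : ℝ) ∨
        6 * l * (((l : ℝ) + 5) - 4 * Cor22.dmod P) / (((l : ℝ) + 4) * ((l : ℝ) - 3))
            * (P.logDiff + (1 - 1 / (l : ℝ)) * Cor22.logCondAvoid P {2, l})
          + 6 * l * ((l : ℝ) + 5) / (((l : ℝ) + 4) * ((l : ℝ) - 3)) * Real.log Real.pi < Cor22.logQAvoid P {2, l}) →
      ∀ (T : Cor22.ThetaVolumeDatumAt P l), letI := T.instFieldF; letI := T.instNumberFieldF; letI := T.instAlgebraF; letI := T.instFieldK;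
        letI := T.instNumberFieldK; letI := T.instAlgebraK; letI := T.instFieldFbar; letI := T.instAlgebraFbar;
        letI := T.instAlgebraKFbar; letI := T.instIsElliptic;
      (∃ (pp : Nat.Primes) (_ : 2 < (pp : ℕ)) (i : Fin (thetaIndex (pilotDataOfK T.D T.K)).lstar)
          (x₀ : (thetaIndex (pilotDataOfK T.D T.K)).Fibre (.inr pp)),
        haveI : Fact (pp : ℕ).Prime := ⟨pp.2⟩
        ((pp : ℕ) : ℝ) ^ ((((i : ℕ) : ℝ) + 2) * (4 + 2 * Real.logb (pp : ℕ) (Module.finrank ℚ T.K)) + 1) *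
          ‖(exists_realising_qIdeles_pilotDataOfK T.D).choose pp x₀‖ ^ (((i : ℕ) + 1) ^ 2 - 1) < 1) → T.Cor312Of)
    -- [CONE, Szpiro-bad] the off-regime hull estimate with print's constant `B_III(P,l)`, demanded ONLY at SZPIRO-BAD admissible `(P, l)`
    (hregBad : ∀ P : NFPoint, P ∈ UP → ∀ l : ℕ, l.Prime → 5 ≤ l →
      Cor22.AdmitsCore P → Cor22.CondP2 P l → Cor22.CondP5 P l → Cor22.CondP6 P l →
      (((l : ℝ) + 5) / 4 < (Cor22.dmod P : ℝ) ∨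
        6 * l * (((l : ℝ) + 5) - 4 * Cor22.dmod P) / (((l : ℝ) + 4) * ((l : ℝ) - 3))
            * (P.logDiff + (1 - 1 / (l : ℝ)) * Cor22.logCondAvoid P {2, l})
          + 6 * l * ((l : ℝ) + 5) / (((l : ℝ) + 4) * ((l : ℝ) - 3)) * Real.log Real.pi < Cor22.logQAvoid P {2, l}) →
      ∀ T : Cor22.ThetaVolumeDatumAt P l,
        (letI := T.instFieldF; letI := T.instNumberFieldF; letI := T.instAlgebraF; letI := T.instFieldK
         letI := T.instNumberFieldK; letI := T.instAlgebraK; letI := T.instFieldFbar; letI := T.instAlgebraFbar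
         letI := T.instAlgebraKFbar; letI := T.instIsElliptic
         ¬ (∀ p ∈ T.I.supportPrimes, ∀ v w : placesOver (fieldOfModuli T.E) p,
            (Summit.ABC.IUTFork.DHData.ofInput T.I).logQloc p v = (Summit.ABC.IUTFork.DHData.ofInput T.I).logQloc p w)) →
        T.HullEstimateOf
          (((l : ℝ) + 1) / 4 *
            ((1 + 12 * (Cor22.dmod P : ℝ) / l) * (P.logDiff + Cor22.logCondAvoid P {2, l})
              + 2 * Real.log l + 52
              + 20 / 3 * Real.log (((2 ^ 12 * 3 ^ 3 * 5 * Cor22.dmod P : ℕ) : ℝ) * (l : ℝ))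
                * (Nat.primeCounting (2 ^ 12 * 3 ^ 3 * 5 * Cor22.dmod P * l) : ℝ))))
    : _root_.ABC :=
  abc_of_k2Target27_of_hStar27OnSigma27_hregBad
    (k2Target27_of_jInv_mem_range_untied M archPk archSub Ψ act Mmod region n lat sig split qData hJT) hS hNumBad hregBad

end KFamily

end Summit.ABC.IUTFork.Repair.RH.ReachLedgerQ2

end
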